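import Literature.Topology.FourManifolds.CircleDiffeotopyProofs
import Literature.Topology.FourManifolds.TubeUntwistFamily
import Mathlib.Analysis.SpecialFunctions.Trigonometric.Deriv
import HarnessLib

/-!
# The explicit circle untwist, quantitatively (a-priori constants for codimension two)

Topic `Literature/Topology/FourManifolds`; the codimension-two untwist zone of the smoothing of PD
homeomorphisms (Munkres, Ann. of Math. 72 (1960), §5; Campbell–D'Onofrio–Vítek (2026), §4, where the
input `Diff⁺(S¹) ≃ SO(2)` is used).  For circle links (`k = 1`) the diffeotopy from `H_2` must be
A PRIORI, i.e. with constants controlled by the link map, because triangle zones are read by edges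
and vertices through curved chart transitions (`ExportAlgebraOffsets`).  The tree's
`CircleDiffeotopyProofs.lean` (Hirsch (1976), Thm. 8.3.3) already provides the explicit
diffeotopy of a positive lift `Φ`: the descended interpolated lifts
`circleDescend (liftInterp Φ c)`, `c ∈ [0, 1]`, with lift derivative `(1 − c) + c Φ'`.  Here we
supply the quantitative ambient calculus the tube zones consume (`TubeExportsRadial`,
`TubeExportsBounds`): for a `2π`-equivariant smooth `Φ` and the ambient map

  `descendAmbient θ₀ Φ y = ↑(circleDescend Φ (radialProjection θ₀ y)) : 𝔼 2`,

* `descendAmbient_smul_circlePoint` : `descendAmbient θ₀ Φ (ρ • circlePoint θ) = circlePoint (Φ θ)`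
  for `ρ > 0`;
* `fderiv_descendAmbient_tangent` : `D(descendAmbient)(ρ • circlePoint θ) (circleTangent θ) =
  (Φ' θ / ρ) • circleTangent (Φ θ)`;
* `norm_fderiv_descendAmbient_of_inner_eq_zero` : for `w ⊥ y`, `y ≠ 0`,
  `‖y‖ · ‖D(descendAmbient)(y) w‖ = |Φ' (argE y)| · ‖w‖` — so the angular constant of the
  interpolated family is `min (1, inf Φ')` and its fibre derivative is `≤ max (1, sup Φ')`,
  both a priori.

Plane calculus only (`circlePoint`, its unit tangent `circleTangent`, the polar map
`(ρ, θ) ↦ ρ • circlePoint θ`); definitions are explicit functions; no named facts.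

## References

* M. W. Hirsch, *Differential Topology*, GTM 33 (1976), Ch. 8 §3, Thm. 3.3. [HirschDT1976]
* J. R. Munkres, *Obstructions to the smoothing of piecewise-differentiable homeomorphisms*, Ann.
  of Math. (2) 72 (1960), 521–554, §5. [Munkres1960]
-/

noncomputable section

open Set Function Metric Filter Real
open scoped Topology ContDiff Manifold RealInnerProductSpace

namespace Literature.Topology.FourManifolds

local notation "𝔼²" => EuclideanSpace ℝ (Fin (1 + 1))
local notation "𝕊¹" => (Metric.sphere (0 : EuclideanSpace ℝ (Fin (1 + 1))) 1)

/-! ### Plane calculus of `circlePoint` -/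

/-- The two coordinate vectors of the plane. [folklore] -/
def untwistE0 : 𝔼² := EuclideanSpace.single (0 : Fin 2) (1 : ℝ)

/-- The two coordinate vectors of the plane. [folklore] -/
def untwistE1 : 𝔼² := EuclideanSpace.single (1 : Fin 2) (1 : ℝ)

/-- **The unit tangent** `circleTangent θ = (−sin θ, cos θ)` of the circle at `circlePoint θ`.
[folklore] -/
def circleTangent (θ : ℝ) : 𝔼² := (-Real.sin θ) • untwistE0 + Real.cos θ • untwistE1

/-- Coordinates of `e₀`. [folklore] -/
@[simp] theorem untwistE0_apply_zero : untwistE0 0 = 1 := by simp [untwistE0]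
/-- Coordinates of `e₀`. [folklore] -/
@[simp] theorem untwistE0_apply_one : untwistE0 1 = 0 := by simp [untwistE0]
/-- Coordinates of `e₁`. [folklore] -/
@[simp] theorem untwistE1_apply_zero : untwistE1 0 = 0 := by simp [untwistE1]
/-- Coordinates of `e₁`. [folklore] -/
@[simp] theorem untwistE1_apply_one : untwistE1 1 = 1 := by simp [untwistE1]

/-- `circlePoint θ = cos θ • e₀ + sin θ • e₁` in the ambient plane. [folklore] -/
theorem coe_circlePoint_eq_smul_add (θ : ℝ) :
    ((circlePoint θ : 𝕊¹) : 𝔼²) = Real.cos θ • untwistE0 + Real.sin θ • untwistE1 := by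
  ext i
  fin_cases i <;> simp [circlePoint_apply_zero, circlePoint_apply_one]

/-- Coordinates of the unit tangent. [folklore] -/
@[simp] theorem circleTangent_apply_zero (θ : ℝ) : circleTangent θ 0 = -Real.sin θ := by
  simp [circleTangent]

/-- Coordinates of the unit tangent. [folklore] -/
@[simp] theorem circleTangent_apply_one (θ : ℝ) : circleTangent θ 1 = Real.cos θ := by
  simp [circleTangent]

/-- Inner products in the plane in coordinates. [folklore] -/
theorem inner_plane (a b : 𝔼²) : ⟪a, b⟫ = a 0 * b 0 + a 1 * b 1 := by
  rw [PiLp.inner_apply, Fin.sum_univ_two]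
  simp only [RCLike.inner_apply, conj_trivial]
  ring

/-- The unit tangent has norm one. [folklore] -/
theorem norm_circleTangent (θ : ℝ) : ‖circleTangent θ‖ = 1 := by
  rw [EuclideanSpace.norm_eq, Fin.sum_univ_two, circleTangent_apply_zero, circleTangent_apply_one]
  simp [Real.norm_eq_abs, sq_abs, Real.sin_sq_add_cos_sq]

/-- The unit tangent is orthogonal to the point. [folklore] -/
theorem inner_circlePoint_circleTangent (θ : ℝ) : ⟪((circlePoint θ : 𝕊¹) : 𝔼²), circleTangent θ⟫ = 0 := by
  rw [inner_plane, circlePoint_apply_zero, circlePoint_apply_one, circleTangent_apply_zero,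
    circleTangent_apply_one]
  ring

/-- **Orthonormal decomposition in the plane**: `w = ⟪w, P θ⟫ • P θ + ⟪w, P' θ⟫ • P' θ`.
[folklore] -/
theorem plane_decomposition (θ : ℝ) (w : 𝔼²) :
    w = ⟪w, ((circlePoint θ : 𝕊¹) : 𝔼²)⟫ • ((circlePoint θ : 𝕊¹) : 𝔼²) + ⟪w, circleTangent θ⟫ • circleTangent θ := by
  have hcs := Real.sin_sq_add_cos_sq θ
  ext i
  fin_cases i
  · simp only [Fin.zero_eta, Fin.isValue, PiLp.add_apply, PiLp.smul_apply, smul_eq_mul, inner_plane,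
      circlePoint_apply_zero, circlePoint_apply_one, circleTangent_apply_zero, circleTangent_apply_one]
    linear_combination (-(w 0)) * hcs
  · simp only [Fin.mk_one, Fin.isValue, PiLp.add_apply, PiLp.smul_apply, smul_eq_mul, inner_plane,
      circlePoint_apply_zero, circlePoint_apply_one, circleTangent_apply_zero, circleTangent_apply_one]
    linear_combination (-(w 1)) * hcs

/-- A vector orthogonal to `circlePoint θ` is a multiple of the unit tangent, with coefficient of
absolute value its norm. [folklore] -/
theorem eq_smul_circleTangent_of_inner_eq_zero (θ : ℝ) {w : 𝔼²}
    (hw : ⟪((circlePoint θ : 𝕊¹) : 𝔼²), w⟫ = 0) :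
    w = ⟪w, circleTangent θ⟫ • circleTangent θ ∧ |⟪w, circleTangent θ⟫| = ‖w‖ := by
  have h := plane_decomposition θ w
  rw [real_inner_comm] at hw
  rw [hw, zero_smul, zero_add] at h
  refine ⟨h, ?_⟩
  conv_rhs => rw [h]
  rw [norm_smul, Real.norm_eq_abs, norm_circleTangent, mul_one]

/-- **Derivative of `circlePoint`** as a plane curve: `P' = circleTangent`. [folklore] -/
theorem hasDerivAt_coe_circlePoint (θ : ℝ) :
    HasDerivAt (fun t : ℝ => ((circlePoint t : 𝕊¹) : 𝔼²)) (circleTangent θ) θ := by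
  have h : (fun t : ℝ => ((circlePoint t : 𝕊¹) : 𝔼²)) = fun t => Real.cos t • untwistE0 + Real.sin t • untwistE1 :=
    funext coe_circlePoint_eq_smul_add
  rw [h, circleTangent]
  exact ((Real.hasDerivAt_cos θ).smul_const untwistE0).add ((Real.hasDerivAt_sin θ).smul_const untwistE1)

/-! ### The polar map -/

/-- The polar map `(ρ, θ) ↦ ρ • circlePoint θ`. [folklore] -/
def polarMap (q : ℝ × ℝ) : 𝔼² := q.1 • ((circlePoint q.2 : 𝕊¹) : 𝔼²)

/-- Composition of a plane curve with the second projection. [folklore] -/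
theorem hasFDerivAt_comp_snd {γ : ℝ → 𝔼²} {v : 𝔼²} (q : ℝ × ℝ) (hγ : HasDerivAt γ v q.2) :
    HasFDerivAt (fun p : ℝ × ℝ => γ p.2) ((ContinuousLinearMap.snd ℝ ℝ ℝ).smulRight v) q := by
  have hsnd : HasFDerivAt (fun p : ℝ × ℝ => p.2) (ContinuousLinearMap.snd ℝ ℝ ℝ) q := hasFDerivAt_snd
  have hγ' : HasFDerivAt γ (ContinuousLinearMap.toSpanSingleton ℝ v) ((fun p : ℝ × ℝ => p.2) q) := hγ.hasFDerivAt
  have h := hγ'.comp q hsnd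
  refine h.congr_fderiv (ContinuousLinearMap.ext fun w => ?_)
  simp [ContinuousLinearMap.smulRight_apply, ContinuousLinearMap.toSpanSingleton_apply]

/-- **Derivative of the polar map**: `D polarMap (ρ, θ) (a, b) = (ρ b) • P' θ + a • P θ`. [folklore] -/
theorem hasFDerivAt_polarMap (q : ℝ × ℝ) :
    HasFDerivAt polarMap
      (q.1 • (ContinuousLinearMap.snd ℝ ℝ ℝ).smulRight (circleTangent q.2) +
        (ContinuousLinearMap.fst ℝ ℝ ℝ).smulRight ((circlePoint q.2 : 𝕊¹) : 𝔼²)) q := by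
  have h1 : HasFDerivAt (fun p : ℝ × ℝ => p.1) (ContinuousLinearMap.fst ℝ ℝ ℝ) q := hasFDerivAt_fst
  have h2 : HasFDerivAt (fun p : ℝ × ℝ => ((circlePoint p.2 : 𝕊¹) : 𝔼²))
      ((ContinuousLinearMap.snd ℝ ℝ ℝ).smulRight (circleTangent q.2)) q :=
    hasFDerivAt_comp_snd q (hasDerivAt_coe_circlePoint q.2)
  exact h1.smul h2

/-- The polar map at `(0, 1)`-direction: `D polarMap (ρ, θ) (0, 1) = ρ • P' θ`. [folklore] -/
theorem fderiv_polarMap_apply_zero_one (q : ℝ × ℝ) :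
    fderiv ℝ polarMap q (0, 1) = q.1 • circleTangent q.2 := by
  rw [(hasFDerivAt_polarMap q).fderiv]
  simp [ContinuousLinearMap.smulRight_apply]

/-! ### The descended map in the ambient plane -/

variable (θ₀ : 𝕊¹)

/-- **The descended lift as an ambient map**: `y ↦ circleDescend Φ (y/‖y‖)` (junk at `0`).
[folklore] -/
def descendAmbient (Φ : ℝ → ℝ) (y : 𝔼²) : 𝔼² := ((circleDescend Φ (radialProjection θ₀ y) : 𝕊¹) : 𝔼²)

variable {θ₀} {Φ : ℝ → ℝ}

/-- On the ray through `circlePoint θ`: `descendAmbient θ₀ Φ (ρ • P θ) = P (Φ θ)` for `ρ > 0`.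
[folklore] -/
theorem descendAmbient_smul_circlePoint (hΦ : ∀ θ, Φ (θ + 2 * π) = Φ θ + 2 * π) {ρ : ℝ} (hρ : 0 < ρ)
    (θ : ℝ) :
    descendAmbient θ₀ Φ (ρ • ((circlePoint θ : 𝕊¹) : 𝔼²)) = ((circlePoint (Φ θ) : 𝕊¹) : 𝔼²) := by
  rw [descendAmbient, radialProjection_smul θ₀ hρ (circlePoint θ), circleDescend_circlePoint hΦ]

/-- The descended map along the polar map: `descendAmbient ∘ polarMap = P ∘ Φ ∘ snd` on `{ρ > 0}`.
[folklore] -/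
theorem descendAmbient_polarMap_eventuallyEq (hΦ : ∀ θ, Φ (θ + 2 * π) = Φ θ + 2 * π) {q : ℝ × ℝ}
    (hq : 0 < q.1) :
    (fun p : ℝ × ℝ => descendAmbient θ₀ Φ (polarMap p)) =ᶠ[𝓝 q]
      fun p => ((circlePoint (Φ p.2) : 𝕊¹) : 𝔼²) := by
  have ho : IsOpen {p : ℝ × ℝ | 0 < p.1} := isOpen_lt continuous_const continuous_fst
  filter_upwards [ho.mem_nhds hq] with p hp
  exact descendAmbient_smul_circlePoint hΦ hp p.2

/-- **Smoothness of the descended map off the origin** (manifold smoothness of the radial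
projection, of `circleDescend`, and of the inclusion of the circle). [folklore] -/
theorem contDiffAt_descendAmbient (hΦ : ∀ θ, Φ (θ + 2 * π) = Φ θ + 2 * π) (hs : ContDiff ℝ ∞ Φ)
    {y : 𝔼²} (hy : y ≠ 0) : ContDiffAt ℝ ∞ (descendAmbient θ₀ Φ) y := by
  have h1 : ContMDiffAt 𝓘(ℝ, 𝔼²) (𝓡 1) ∞ (radialProjection θ₀) y := contMDiffAt_radialProjection θ₀ hy
  have h2 : ContMDiff (𝓡 1) (𝓡 1) ∞ (circleDescend Φ) := contMDiff_circleDescend hΦ hs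
  haveI : Fact (Module.finrank ℝ (EuclideanSpace ℝ (Fin (1 + 1))) = 1 + 1) := ⟨finrank_euclideanSpace_fin⟩
  have h3 : ContMDiff (𝓡 1) 𝓘(ℝ, 𝔼²) ∞ (fun u : 𝕊¹ => (u : 𝔼²)) := contMDiff_coe_sphere (n := 1) (m := ∞)
  have h := (h3.comp h2).contMDiffAt.comp y h1
  exact contMDiffAt_iff_contDiffAt.1 h

/-- **The fibre derivative along the tangent**: at `y = ρ • P θ`, `ρ > 0`,
`D(descendAmbient)(y) (ρ • P' θ) = Φ'(θ) • P'(Φ θ)`. [folklore] -/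
theorem fderiv_descendAmbient_smul_tangent (hΦ : ∀ θ, Φ (θ + 2 * π) = Φ θ + 2 * π) (hs : ContDiff ℝ ∞ Φ)
    {ρ : ℝ} (hρ : 0 < ρ) (θ : ℝ) :
    fderiv ℝ (descendAmbient θ₀ Φ) (ρ • ((circlePoint θ : 𝕊¹) : 𝔼²)) (ρ • circleTangent θ) =
      deriv Φ θ • circleTangent (Φ θ) := by
  set y : 𝔼² := ρ • ((circlePoint θ : 𝕊¹) : 𝔼²) with hy
  have hy0 : y ≠ 0 := smul_ne_zero hρ.ne' (ne_zero_of_mem_unit_sphere (circlePoint θ))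
  have hdiff : DifferentiableAt ℝ (descendAmbient θ₀ Φ) y :=
    (contDiffAt_descendAmbient hΦ hs hy0).differentiableAt (by simp)
  -- chain rule along the polar map at `q = (ρ, θ)`
  have hq : polarMap (ρ, θ) = y := rfl
  have hcomp : HasFDerivAt (fun p : ℝ × ℝ => descendAmbient θ₀ Φ (polarMap p))
      ((fderiv ℝ (descendAmbient θ₀ Φ) y).comp (fderiv ℝ polarMap (ρ, θ))) (ρ, θ) := by
    have h := hdiff.hasFDerivAt
    rw [← hq] at h
    exact h.comp (ρ, θ) (hasFDerivAt_polarMap (ρ, θ)).differentiableAt.hasFDerivAt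
  -- the same function is `P ∘ Φ ∘ snd` near `(ρ, θ)`
  have hexp : HasFDerivAt (fun p : ℝ × ℝ => descendAmbient θ₀ Φ (polarMap p))
      ((ContinuousLinearMap.snd ℝ ℝ ℝ).smulRight (deriv Φ θ • circleTangent (Φ θ))) (ρ, θ) := by
    have hd : HasDerivAt (fun t : ℝ => ((circlePoint (Φ t) : 𝕊¹) : 𝔼²)) (deriv Φ θ • circleTangent (Φ θ)) θ := by
      have := (hasDerivAt_coe_circlePoint (Φ θ)).scomp θ ((hs.differentiable (by simp)) θ).hasDerivAt
      exact this
    have h2 : HasFDerivAt (fun p : ℝ × ℝ => ((circlePoint (Φ p.2) : 𝕊¹) : 𝔼²))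
        ((ContinuousLinearMap.snd ℝ ℝ ℝ).smulRight (deriv Φ θ • circleTangent (Φ θ))) (ρ, θ) :=
      hasFDerivAt_comp_snd (γ := fun t : ℝ => ((circlePoint (Φ t) : 𝕊¹) : 𝔼²)) (ρ, θ) hd
    exact h2.congr_of_eventuallyEq (descendAmbient_polarMap_eventuallyEq hΦ hρ)
  have huniq := hcomp.unique hexp
  -- evaluate at `(0, 1)`
  have h := congrArg (fun L : ℝ × ℝ →L[ℝ] 𝔼² => L (0, 1)) huniq
  simp only [ContinuousLinearMap.comp_apply, ContinuousLinearMap.smulRight_apply,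
    ContinuousLinearMap.coe_snd', one_smul] at h
  rw [fderiv_polarMap_apply_zero_one] at h
  exact h

/-- **The fibre derivative of the descended map at a vector orthogonal to the ray**:
`‖y‖ · ‖D(descendAmbient)(y) w‖ = |Φ'(θ)| · ‖w‖` for `y = ρ • P θ`, `ρ > 0`, `w ⊥ y`. [folklore] -/
theorem norm_fderiv_descendAmbient_of_inner_eq_zero (hΦ : ∀ θ, Φ (θ + 2 * π) = Φ θ + 2 * π)
    (hs : ContDiff ℝ ∞ Φ) {ρ : ℝ} (hρ : 0 < ρ) (θ : ℝ) {w : 𝔼²}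
    (hw : ⟪ρ • ((circlePoint θ : 𝕊¹) : 𝔼²), w⟫ = 0) :
    ρ * ‖fderiv ℝ (descendAmbient θ₀ Φ) (ρ • ((circlePoint θ : 𝕊¹) : 𝔼²)) w‖ = |deriv Φ θ| * ‖w‖ := by
  -- `w = β • P' θ` with `|β| = ‖w‖`
  have hw' : ⟪((circlePoint θ : 𝕊¹) : 𝔼²), w⟫ = 0 := by
    rw [inner_smul_left] at hw
    simpa [hρ.ne'] using hw
  obtain ⟨hdec, hβ⟩ := eq_smul_circleTangent_of_inner_eq_zero θ hw'
  set β : ℝ := ⟪w, circleTangent θ⟫ with hβdef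
  have hlin : fderiv ℝ (descendAmbient θ₀ Φ) (ρ • ((circlePoint θ : 𝕊¹) : 𝔼²)) w =
      (β / ρ) • (deriv Φ θ • circleTangent (Φ θ)) := by
    have e : w = (β / ρ) • (ρ • circleTangent θ) := by
      rw [smul_smul, div_mul_cancel₀ β hρ.ne']; exact hdec
    rw [e, map_smul, fderiv_descendAmbient_smul_tangent hΦ hs hρ θ]
  rw [hlin, norm_smul, norm_smul, Real.norm_eq_abs, Real.norm_eq_abs, norm_circleTangent, mul_one, abs_div,
    abs_of_pos hρ, hβ]
  field_simp

/-! ### Every nonzero vector is `‖y‖ • circlePoint θ`; uniform bounds -/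

/-- Every nonzero plane vector is `‖y‖ • circlePoint θ` for some angle. [folklore] -/
theorem exists_eq_norm_smul_circlePoint (θ₀ : 𝕊¹) {y : 𝔼²} (hy : y ≠ 0) :
    ∃ θ : ℝ, y = ‖y‖ • ((circlePoint θ : 𝕊¹) : 𝔼²) := by
  refine ⟨2 * Real.pi * angA (radialProjection θ₀ y), ?_⟩
  rw [circlePoint_two_pi_mul_angA, coe_radialProjection_of_ne_zero θ₀ hy, smul_smul,
    mul_inv_cancel₀ (norm_ne_zero_iff.2 hy), one_smul]

/-- **Uniform fibre bounds of a descended lift.** If `m ≤ Φ' ≤ M` everywhere then for every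
`y ≠ 0` and `w ⊥ y`, `m ‖w‖ ≤ ‖y‖ · ‖D(descendAmbient)(y) w‖ ≤ M ‖w‖` (`0 ≤ m`). [folklore] -/
theorem norm_fderiv_descendAmbient_bounds (θ₀ : 𝕊¹) (hΦ : ∀ θ, Φ (θ + 2 * π) = Φ θ + 2 * π)
    (hs : ContDiff ℝ ∞ Φ) {m M : ℝ} (hm : ∀ θ, m ≤ deriv Φ θ) (hM : ∀ θ, deriv Φ θ ≤ M)
    (hm0 : 0 ≤ m) {y : 𝔼²} (hy : y ≠ 0) {w : 𝔼²} (hw : ⟪y, w⟫ = 0) :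
    m * ‖w‖ ≤ ‖y‖ * ‖fderiv ℝ (descendAmbient θ₀ Φ) y w‖ ∧
      ‖y‖ * ‖fderiv ℝ (descendAmbient θ₀ Φ) y w‖ ≤ M * ‖w‖ := by
  obtain ⟨θ, hθ⟩ := exists_eq_norm_smul_circlePoint θ₀ hy
  have hρ : 0 < ‖y‖ := norm_pos_iff.2 hy
  have hw' : ⟪‖y‖ • ((circlePoint θ : 𝕊¹) : 𝔼²), w⟫ = 0 := by rw [← hθ]; exact hw
  have h := norm_fderiv_descendAmbient_of_inner_eq_zero (θ₀ := θ₀) hΦ hs hρ θ hw'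
  rw [← hθ] at h
  rw [h]
  have habs : m ≤ |deriv Φ θ| ∧ |deriv Φ θ| ≤ M := by
    rw [abs_of_nonneg (hm0.trans (hm θ))]; exact ⟨hm θ, hM θ⟩
  exact ⟨mul_le_mul_of_nonneg_right habs.1 (norm_nonneg _), mul_le_mul_of_nonneg_right habs.2 (norm_nonneg _)⟩

/-! ### The interpolated lifts: a-priori derivative bounds and the speed of the diffeotopy -/

/-- **Derivative bounds of the interpolated lift**: for `c ∈ [0, 1]` and `m ≤ Φ' ≤ M`,
`min 1 m ≤ (liftInterp Φ c)' ≤ max 1 M`. [folklore] -/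
theorem deriv_liftInterp_bounds {Φ : ℝ → ℝ} (hd : Differentiable ℝ Φ) {m M : ℝ}
    (hm : ∀ θ, m ≤ deriv Φ θ) (hM : ∀ θ, deriv Φ θ ≤ M) {c : ℝ} (hc : c ∈ Icc (0 : ℝ) 1) (θ : ℝ) :
    min 1 m ≤ deriv (liftInterp Φ c) θ ∧ deriv (liftInterp Φ c) θ ≤ max 1 M := by
  rw [(hasDerivAt_liftInterp (hd θ).hasDerivAt c).deriv]
  have e : 1 + c * (deriv Φ θ - 1) = (1 - c) * 1 + c * deriv Φ θ := by ring
  rw [e]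
  constructor
  · calc min 1 m = (1 - c) * min 1 m + c * min 1 m := by ring
      _ ≤ (1 - c) * 1 + c * deriv Φ θ :=
          add_le_add (mul_le_mul_of_nonneg_left (min_le_left _ _) (by linarith [hc.2]))
            (mul_le_mul_of_nonneg_left ((min_le_right _ _).trans (hm θ)) hc.1)
  · calc (1 - c) * 1 + c * deriv Φ θ ≤ (1 - c) * max 1 M + c * max 1 M :=
          add_le_add (mul_le_mul_of_nonneg_left (le_max_left _ _) (by linarith [hc.2]))
            (mul_le_mul_of_nonneg_left ((hM θ).trans (le_max_right _ _)) hc.1)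
      _ = max 1 M := by ring

/-- **Uniform fibre bounds of the descended interpolated lifts**, for all `c ∈ [0, 1]` at once:
`min 1 m · ‖w‖ ≤ ‖y‖ · ‖D(descendAmbient θ₀ (liftInterp Φ c))(y) w‖ ≤ max 1 M · ‖w‖`. [folklore] -/
theorem norm_fderiv_descendAmbient_liftInterp_bounds (θ₀ : 𝕊¹) (hΦ : ∀ θ, Φ (θ + 2 * π) = Φ θ + 2 * π)
    (hs : ContDiff ℝ ∞ Φ) {m M : ℝ} (hm : ∀ θ, m ≤ deriv Φ θ) (hM : ∀ θ, deriv Φ θ ≤ M) (hm0 : 0 ≤ m)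
    {c : ℝ} (hc : c ∈ Icc (0 : ℝ) 1) {y : 𝔼²} (hy : y ≠ 0) {w : 𝔼²} (hw : ⟪y, w⟫ = 0) :
    min 1 m * ‖w‖ ≤ ‖y‖ * ‖fderiv ℝ (descendAmbient θ₀ (liftInterp Φ c)) y w‖ ∧
      ‖y‖ * ‖fderiv ℝ (descendAmbient θ₀ (liftInterp Φ c)) y w‖ ≤ max 1 M * ‖w‖ := by
  have hd : Differentiable ℝ Φ := hs.differentiable (by simp)
  exact norm_fderiv_descendAmbient_bounds θ₀ (liftInterp_add_two_pi hΦ c) (contDiff_liftInterp hs c)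
    (fun θ => (deriv_liftInterp_bounds hd hm hM hc θ).1) (fun θ => (deriv_liftInterp_bounds hd hm hM hc θ).2)
    (le_min zero_le_one hm0) hy hw

/-- **The descended interpolated lift on a ray**:
`descendAmbient θ₀ (liftInterp Φ c) (ρ • P θ) = P (θ + c (Φ θ − θ))`. [folklore] -/
theorem descendAmbient_liftInterp_smul_circlePoint (hΦ : ∀ θ, Φ (θ + 2 * π) = Φ θ + 2 * π) {ρ : ℝ}
    (hρ : 0 < ρ) (c θ : ℝ) :
    descendAmbient θ₀ (liftInterp Φ c) (ρ • ((circlePoint θ : 𝕊¹) : 𝔼²)) =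
      ((circlePoint (θ + c * (Φ θ - θ)) : 𝕊¹) : 𝔼²) := by
  rw [descendAmbient_smul_circlePoint (liftInterp_add_two_pi hΦ c) hρ θ, liftInterp_apply]

/-- **Speed of the interpolation in the parameter**: on the ray through `P θ`,
`d/dc descendAmbient θ₀ (liftInterp Φ c) (ρ • P θ) = (Φ θ − θ) • P' (θ + c (Φ θ − θ))`. [folklore] -/
theorem hasDerivAt_descendAmbient_liftInterp_param (hΦ : ∀ θ, Φ (θ + 2 * π) = Φ θ + 2 * π) {ρ : ℝ}
    (hρ : 0 < ρ) (θ c : ℝ) :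
    HasDerivAt (fun c' : ℝ => descendAmbient θ₀ (liftInterp Φ c') (ρ • ((circlePoint θ : 𝕊¹) : 𝔼²)))
      ((Φ θ - θ) • circleTangent (θ + c * (Φ θ - θ))) c := by
  have hfun : (fun c' : ℝ => descendAmbient θ₀ (liftInterp Φ c') (ρ • ((circlePoint θ : 𝕊¹) : 𝔼²))) =
      fun c' => ((circlePoint (θ + c' * (Φ θ - θ)) : 𝕊¹) : 𝔼²) :=
    funext fun c' => descendAmbient_liftInterp_smul_circlePoint hΦ hρ c' θ
  rw [hfun]
  have hin : HasDerivAt (fun c' : ℝ => θ + c' * (Φ θ - θ)) (Φ θ - θ) c := by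
    simpa using ((hasDerivAt_id c).mul_const (Φ θ - θ)).const_add θ
  have := (hasDerivAt_coe_circlePoint (θ + c * (Φ θ - θ))).scomp c hin
  exact this

/-- The speed has norm `|Φ θ − θ|`. [folklore] -/
theorem norm_deriv_descendAmbient_liftInterp_param (hΦ : ∀ θ, Φ (θ + 2 * π) = Φ θ + 2 * π) {ρ : ℝ}
    (hρ : 0 < ρ) (θ c : ℝ) :
    ‖deriv (fun c' : ℝ => descendAmbient θ₀ (liftInterp Φ c') (ρ • ((circlePoint θ : 𝕊¹) : 𝔼²))) c‖ =
      |Φ θ - θ| := by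
  rw [(hasDerivAt_descendAmbient_liftInterp_param hΦ hρ θ c).deriv, norm_smul, Real.norm_eq_abs,
    norm_circleTangent, mul_one]

/-- **A-priori bound for the displacement `Φ θ − θ` of an equivariant lift** from a bound on
`[0, 2π]` (the displacement is `2π`-periodic). [folklore] -/
theorem abs_sub_self_le_of_periodic {Φ : ℝ → ℝ} (hΦ : ∀ θ, Φ (θ + 2 * π) = Φ θ + 2 * π) {B : ℝ}
    (hB : ∀ θ ∈ Icc (0 : ℝ) (2 * π), |Φ θ - θ| ≤ B) (θ : ℝ) : |Φ θ - θ| ≤ B := by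
  have hper := periodic_sub_self_of_add_two_pi hΦ
  -- reduce `θ` modulo `2π`
  set θ' : ℝ := toIcoMod Real.two_pi_pos 0 θ with hθ'
  have hmem : θ' ∈ Ico (0 : ℝ) (0 + 2 * π) := toIcoMod_mem_Ico Real.two_pi_pos 0 θ
  have hdecomp : θ' + toIcoDiv Real.two_pi_pos 0 θ • (2 * π) = θ := toIcoMod_add_toIcoDiv_zsmul Real.two_pi_pos 0 θ
  have hval : Φ θ - θ = Φ θ' - θ' := by
    have h := hper.zsmul (toIcoDiv Real.two_pi_pos 0 θ) θ'
    -- `h : Φ (θ' + k • 2π) - (θ' + k • 2π) = Φ θ' - θ'`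
    rw [hdecomp] at h
    exact h
  rw [hval]
  exact hB θ' ⟨hmem.1, by linarith [hmem.2]⟩

/-- **The displacement bound from a derivative bound**: if `Φ' ≤ M` (`0 ≤ M`) then
`|Φ θ − θ| ≤ |Φ 0| + 2π (M + 1)` for all `θ`. [folklore] -/
theorem abs_sub_self_le_of_deriv_le {Φ : ℝ → ℝ} (hΦ : ∀ θ, Φ (θ + 2 * π) = Φ θ + 2 * π)
    (hd : Differentiable ℝ Φ) {M : ℝ} (hM0 : 0 ≤ M) (hM : ∀ θ, deriv Φ θ ≤ M)
    {m : ℝ} (hm0 : 0 ≤ m) (hm : ∀ θ, m ≤ deriv Φ θ) (θ : ℝ) :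
    |Φ θ - θ| ≤ |Φ 0| + 2 * π * (M + 1) := by
  refine abs_sub_self_le_of_periodic hΦ (fun θ hθ => ?_) θ
  -- mean value on `[0, θ]`: `|Φ θ − Φ 0| ≤ M θ ≤ 2π M`
  have hMV : Φ θ - Φ 0 ≤ M * θ := by
    rcases eq_or_lt_of_le hθ.1 with h0 | h0
    · rw [← h0]; simp
    · obtain ⟨ξ, _, hξ⟩ := exists_deriv_eq_slope Φ h0 hd.continuous.continuousOn
        (fun x _ => (hd x).differentiableWithinAt)
      have : deriv Φ ξ * θ = Φ θ - Φ 0 := by rw [hξ, sub_zero, div_mul_cancel₀ _ h0.ne']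
      nlinarith [hM ξ, hθ.1]
  have hMV' : 0 ≤ Φ θ - Φ 0 := by
    rcases eq_or_lt_of_le hθ.1 with h0 | h0
    · rw [← h0]; simp
    · obtain ⟨ξ, _, hξ⟩ := exists_deriv_eq_slope Φ h0 hd.continuous.continuousOn
        (fun x _ => (hd x).differentiableWithinAt)
      have : deriv Φ ξ * θ = Φ θ - Φ 0 := by rw [hξ, sub_zero, div_mul_cancel₀ _ h0.ne']
      nlinarith [hm ξ, hθ.1]
  rw [abs_le]
  constructor
  · -- lower: `Φ θ − θ ≥ Φ 0 − 2π ≥ −|Φ 0| − 2π(M+1)`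
    have : -|Φ 0| ≤ Φ 0 := neg_abs_le _
    nlinarith [hθ.2, Real.pi_pos]
  · have : Φ 0 ≤ |Φ 0| := le_abs_self _
    nlinarith [hθ.1, hθ.2, Real.pi_pos]

end Literature.Topology.FourManifolds
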